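import Literature.Algebra.EuclideanLattices.RegevRoutineCoreFP
import HarnessLib

/-!
# Regev's per-copy routine as a circuit family, XI: the parameter set and the semantic interface

Eleventh file of the circuit-level construction towards the discharge of
`Literature.Algebra.EuclideanLattices.usvp_of_dihedralCoset` (O. Regev, *Quantum computation and
lattice problems*, SIAM J. Comput. 33 (2004), Thm. 1.1). From the data fixed before the blocks
(`PreParams`: the solver family with its width bound, and the three size polynomials) the two
block functions are assembled — "parse (file VIII), then compute (files IX–X)" —, their `FP`
membership yields machines with power time bounds (`RevClean.exists_outputsWithin_pow_of_mem_FP`),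
and the resulting parameter set `mkParams` of the routine (file I) satisfies the semantic interface
of file V:

* `FW`, `fW` (`fW_mem_FP`, **`fW_wordW`**: on `wordW` the first block writes
  `wOutE (wOut S L x g ix ta k)`); its machine `machW` with exponent `expW` (`machW_spec`);
* `FV`, `fV` (`fV_mem_FP`); its machine `machV`, `expV` (`machV_spec`); **`mkParams`** (`mkParams_sizes`);
* `Act` — liveness of register `k` on input `x` with guesses `g` (file IX's `Live` on the decoded
  payload and the guesses read off the guess zone) and **`semHyp`**: `SemHyp (mkParams Q)` with
  this `Act` (its `hv` is `vOut_wOut` of file IX transported through the parsers).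

No named fact is introduced.

## References

* O. Regev, *Quantum computation and lattice problems*, SIAM J. Comput. 33 (2004) 738–760, proof
  of Lemma 3.12 (p. 14) [Regev2004].
* C. H. Bennett, *Logical reversibility of computation*, IBM J. Res. Develop. 17 (1973), §2
  [Bennett1973].
* S. Arora, B. Barak, *Computational Complexity: A Modern Approach*, CUP 2009, §1.3 [AroraBarak2009].
-/

noncomputable section

namespace Literature.Algebra.EuclideanLattices

namespace RegevRoutine

open _root_.Computability Polynomial Literature.Computability.Complexity Literature.Computability.Complexity.Brick
  Literature.Computability.Complexity.CodeFP Literature.Computability.Cryptography Literature.Computability.QuantumComplexity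
  Turing RevSim RevClean Regev2004

/-! ### The data fixed before the blocks -/

/-- The data of the routine fixed before its block functions: the solver family with a polynomial
width bound, the register-count bound and the sizes of the `ix` field and of the guess zone. [cite: Regev2004, Lemma 3.12 (proof, p. 14)] -/
structure PreParams where
  /-- the solver family -/
  FD : QCircuitFamily cliffordT
  /-- a polynomial bound of its width -/
  pD : Polynomial ℕ
  /-- the bound -/
  hpD : ∀ ℓ, ℓ + FD.ancillas ℓ ≤ pD.eval ℓ
  /-- bound of the number of registers, in terms of `ℓ` -/
  pr : Polynomial ℕ
  /-- size of the `ix` field -/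
  pkap : Polynomial ℕ
  /-- size of the guess zone -/
  pgam : Polynomial ℕ

/-- The size polynomials. [folklore] -/
def PreParams.sizes (Q : PreParams) : Sizes := ⟨Q.pr, Q.pkap, Q.pgam⟩

/-! ### The first block -/

section First

variable (S : Sizes)

/-- The `FP` realisation of the first block's computation on parsed records. [folklore] -/
def FW : List Bool → List Bool := Classical.choose (wOut_codeFP S)

/-- `FW ∈ FP`. [folklore] -/
theorem FW_mem_FP : FW S ∈ FP := (Classical.choose_spec (wOut_codeFP S)).1

/-- `FW` on the code of a record. [folklore] -/
theorem FW_apply (r : WIn) : FW S (inWE r) = wOutE (wOut S r.1 r.2.2.2.1 r.2.2.2.2.1 r.2.1 r.2.2.1 r.2.2.2.2.2) :=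
  (Classical.choose_spec (wOut_codeFP S)).2 r

/-- **The first block function**: parse, then compute. [cite: Regev2004, Lemma 3.12 (proof, p. 14: "we add the value f(t, ā) to the last register")] -/
def fW : List Bool → List Bool := FW S ∘ parseW S

/-- `fW ∈ FP`. [cite: AroraBarak2009, §1.3] -/
theorem fW_mem_FP : fW S ∈ FP := comp_mem_FP (FW_mem_FP S) parseW_mem_FP

/-- A machine of the first block with a power time bound. [cite: AroraBarak2009, §1.3] -/
theorem exists_machineW : ∃ eM : ℕ × TM2ComputableAux Bool Bool, ∀ u, eM.2.OutputsWithin u (fW S u) (Tn eM.1 u.length) := by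
  obtain ⟨e, M, h⟩ := exists_outputsWithin_pow_of_mem_FP (fW_mem_FP S)
  exact ⟨(e, M), h⟩

/-- The time exponent of the first block. [folklore] -/
def expW : ℕ := (Classical.choose (exists_machineW S)).1

/-- The machine of the first block. [folklore] -/
def machW : TM2ComputableAux Bool Bool := (Classical.choose (exists_machineW S)).2

/-- The machine computes `fW` within the time bound. [folklore] -/
theorem machW_spec (u : List Bool) : (machW S).OutputsWithin u (fW S u) (Tn (expW S) u.length) := Classical.choose_spec (exists_machineW S) u

end First

/-! ### The second block -/

section Second

variable (S : Sizes) (e : ℕ) (M : TM2ComputableAux Bool Bool)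

/-- The `FP` realisation of the second block's computation on parsed records. [folklore] -/
def FV : List Bool → List Bool := Classical.choose (vOut_codeFP S)

/-- `FV ∈ FP`. [folklore] -/
theorem FV_mem_FP : FV S ∈ FP := (Classical.choose_spec (vOut_codeFP S)).1

/-- `FV` on the code of a record. [folklore] -/
theorem FV_apply (v : VIn) : FV S (inVE v) = vOut S v.1 v.2.2.1 v.2.2.2.1 v.2.1 v.2.2.2.2.1 v.2.2.2.2.2 :=
  (Classical.choose_spec (vOut_codeFP S)).2 v

/-- **The second block function** (for a first block with exponent `e` and machine `M`): parse —
reading the first block's output off its result wires —, then compute. [cite: Bennett1973, §2] -/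
def fV : List Bool → List Bool := FV S ∘ parseV S e M

/-- `fV ∈ FP`. [cite: AroraBarak2009, §1.3] -/
theorem fV_mem_FP : fV S e M ∈ FP := comp_mem_FP (FV_mem_FP S) parseV_mem_FP

/-- A machine of the second block with a power time bound. [cite: AroraBarak2009, §1.3] -/
theorem exists_machineV : ∃ eM : ℕ × TM2ComputableAux Bool Bool, ∀ u, eM.2.OutputsWithin u (fV S e M u) (Tn eM.1 u.length) := by
  obtain ⟨e', M', h⟩ := exists_outputsWithin_pow_of_mem_FP (fV_mem_FP S e M)
  exact ⟨(e', M'), h⟩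

/-- The time exponent of the second block. [folklore] -/
def expV : ℕ := (Classical.choose (exists_machineV S e M)).1

/-- The machine of the second block. [folklore] -/
def machV : TM2ComputableAux Bool Bool := (Classical.choose (exists_machineV S e M)).2

/-- The machine computes `fV` within the time bound. [folklore] -/
theorem machV_spec (u : List Bool) : (machV S e M).OutputsWithin u (fV S e M u) (Tn (expV S e M) u.length) :=
  Classical.choose_spec (exists_machineV S e M) u

end Second

/-! ### The parameter set -/

/-- **The parameter set of the routine.** [cite: Regev2004, Lemma 3.12 (proof, p. 14)] -/
def mkParams (Q : PreParams) : Params where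
  FD := Q.FD
  pD := Q.pD
  hpD := Q.hpD
  pr := Q.pr
  fW := fW Q.sizes
  eW := expW Q.sizes
  MW := machW Q.sizes
  hMW := machW_spec Q.sizes
  fV := fV Q.sizes (expW Q.sizes) (machW Q.sizes)
  eV := expV Q.sizes (expW Q.sizes) (machW Q.sizes)
  MV := machV Q.sizes (expW Q.sizes) (machW Q.sizes)
  hMV := machV_spec Q.sizes (expW Q.sizes) (machW Q.sizes)
  pkap := Q.pkap
  pgam := Q.pgam

/-- The sizes of the parameter set are the given ones. [folklore] -/
@[simp] theorem mkParams_sizes (Q : PreParams) : (mkParams Q).sizes = Q.sizes := rfl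

/-! ### The blocks on the data words -/

section OnWords

variable (Q : PreParams) {L : ℕ} {x : List Bool} (g ixc tac : ℕ → Bool) {k : ℕ}

/-- The guess zone as a string. [folklore] -/
def gBits (Q : PreParams) (L : ℕ) (g : ℕ → Bool) : List Bool := List.ofFn fun t : Fin (gam (mkParams Q) L) => g t
/-- The `ix` field as a string. [folklore] -/
def ixBits (Q : PreParams) (L : ℕ) (ixc : ℕ → Bool) : List Bool := List.ofFn fun t : Fin (kap (mkParams Q) L) => ixc t
/-- The `ta` field as a string. [folklore] -/
def taBits (L : ℕ) (tac : ℕ → Bool) : List Bool := List.ofFn fun t : Fin (sig L) => tac t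

/-- **The first block on `wordW`.** [cite: Regev2004, Lemma 3.12 (proof, p. 14)] -/
theorem fW_wordW (hx : x.length = L) (hk : k ≤ rmax (mkParams Q) L) :
    (mkParams Q).fW (wordW (mkParams Q) L x g ixc tac k) = wOutE (wOut Q.sizes L x (gBits Q L g) (ixBits Q L ixc) (taBits L tac) k) := by
  change FW Q.sizes (parseW Q.sizes (wordW (mkParams Q) L x g ixc tac k)) = _
  rw [show parseW Q.sizes = parseW (mkParams Q).sizes from rfl, parseW_wordW g ixc tac hx hk, ← unE_eq_ones, ← unE_eq_ones]
  exact FW_apply Q.sizes (L, (ixBits Q L ixc, (taBits L tac, (x, (gBits Q L g, k)))))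

/-- **The second block on `wordV`.** [cite: Bennett1973, §2] -/
theorem fV_wordV (hx : x.length = L) (hk : k ≤ rmax (mkParams Q) L) :
    (mkParams Q).fV (wordV (mkParams Q) L x g ixc tac k) =
      vOut Q.sizes L x (gBits Q L g) (taBits L tac) k (wOut Q.sizes L x (gBits Q L g) (ixBits Q L ixc) (taBits L tac) k) := by
  change FV Q.sizes (parseV Q.sizes (expW Q.sizes) (machW Q.sizes) (wordV (mkParams Q) L x g ixc tac k)) = _
  rw [show parseV Q.sizes (expW Q.sizes) (machW Q.sizes) = parseV (mkParams Q).sizes (mkParams Q).eW (mkParams Q).MW from rfl,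
    parseV_wordV g ixc tac hx hk, fW_wordW Q g ixc tac hx hk, ← unE_eq_ones, ← unE_eq_ones]
  exact FV_apply Q.sizes (L, (taBits L tac, (x, (gBits Q L g, (k, wOut Q.sizes L x (gBits Q L g) (ixBits Q L ixc) (taBits L tac) k)))))

end OnWords

/-! ### The semantic interface -/

/-- **Liveness of register `k`** on input `x` with guesses `g`: file IX's `Live` on the decoded
payload and the guesses read off the guess zone. [cite: Regev2004, Lemma 3.12 (proof, p. 14: r registers)] -/
def Act (Q : PreParams) (L : ℕ) (x : List Bool) (g : ℕ → Bool) (k : ℕ) : Prop :=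
  Live Q.sizes L (payloadOf x) (readGuess Q.sizes L (payloadOf x) (gBits Q L g)) k

/-- Liveness is decidable. [folklore] -/
instance instDecidableAct (Q : PreParams) (L : ℕ) (x : List Bool) (g : ℕ → Bool) (k : ℕ) : Decidable (Act Q L x g k) := by
  unfold Act; infer_instance

/-- **The routine's parameter set satisfies the semantic interface** of file V. [cite: Bennett1973, §2] -/
def semHyp (Q : PreParams) : SemHyp (mkParams Q) where
  Act := Act Q
  dec := fun L x g k => instDecidableAct Q L x g k
  hv := fun L x g ixc tac k hx hk => by
    rw [fV_wordV Q g ixc tac hx hk.le, vOut_wOut _ _ _ _ _ _ _ (by simp [ixBits]; rfl)]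
    rfl

end RegevRoutine

end Literature.Algebra.EuclideanLattices

end
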